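import Summits.ResolutionOfSingularities.ResolutionOfSingularities.Theorems.FrobeniusLadderFInjectiveMacaulayficationCINewtonChartLemma
import Summits.ResolutionOfSingularities.ResolutionOfSingularities.Theorems.FrobeniusLadderFInjectiveMacaulayficationCIJacobian
import Mathlib.LinearAlgebra.Matrix.NonsingularInverse
import Mathlib.LinearAlgebra.Dual.Lemmas
import Mathlib.LinearAlgebra.Dimension.Constructions
import HarnessLib

/-!
# (A3) THE CI ROW ENGINE'S PER-CHART CLAUSE `hon'` FROM GEOMETRIC CI NEWTON NON-DEGENERACY, any field of characteristic `p`
# (crux `FInjectiveMacaulayfication` stmt-ResolutionOfSingularities-15315, chain w45a; res-L1-w45a-plan-1 RULINGs R23.2 (4)(ii) / R23.3 (A3) GO; seat res-L1-w45a-stub-2 g12; the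
# `r`-equation twin of ✓ `NewtonChartHonAnyField.hon_of_geomWeaklyNondegenerate` (this seat) over ✓ `CINewtonChartLemma.ci_rank_of_chart` (A2) and the CI Jacobian criterion
# ✓ `CIJacobian` (res-D-pv-018's CI-CN engine))

[OURS · L1 W4.5a] Support file (`--supports stmt-ResolutionOfSingularities-15315 --as helper`); def-free; UNCONDITIONAL; no named fact; NOT a statement of any manuscript.
AI-written (AI review is weaker than expert review). Nothing of the crux is proved here.

WHAT. The per-chart binder `hon'` of ✓ `CIEnginePrime.ciCertificates_of_isPrime` — for EVERY `r`, `J := univ`, `Fs := F`, `gs c := g c` — from GEOMETRIC CI Newton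
non-degeneracy of `F = (F₀, …, F_{r−1})` (✓ `CINondegenerate.IsCINondegenerateAlong` for `map (algebraMap k K) ∘ F`, `K ⊇ k` algebraically closed) and per-equation refining chart
identities `θ_{V_c} F_l = Y^{d_{c,l}}·g_{c,l}`, `g_{c,l}(0) ≠ 0`: at every MAXIMAL ideal `Q'` of the naive quotient `k[Y]/(g_{c,0..r−1})` over the origin,
(ii) `(k[Y]/(g_c))_{Q'}` carries the CM + Frobenius-closed clause — indeed it is REGULAR: `Q'` is the ideal of a geometric point `y ∈ Kᵐ` (Nullstellensatz,
`MvPolynomial.eq_vanishingIdeal_singleton_of_isMaximal`), (A2) gives linearly independent rows `(∂ᵢ g_{c,l}(y))_{i ∉ S}`, hence an `r×r` minor `det(∂_{js μ} g_{c,l})` with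
non-zero value at `y`, hence `∉ Q'`, and ✓ `CIJacobian.ci_clause_of_det_not_mem` concludes;
(i) each `Yᵢ ∈ Q'` is a non-zero-divisor on `k[Y]_{Q' ∩ k[Y]} ⧸ (g_c)`: that ring is a DOMAIN (≅ `(k[Y]/(g_c))_{Q'}`, ✓ `CIFedderAtMaximalIdeal.nonempty_quotLocalizationEquiv`), and
`Yᵢ/1 ∉ (g_c)k[Y]_{Q'∩k[Y]}` by a DIMENSION COUNT: the augmented tuple `(Yᵢ, g_c)` has the `(r+1)×(r+1)` minor with the extra row `∂ᵢ` (`∂ᵢYᵢ = 1`, `∂_{js μ}Yᵢ = 0` as `js μ ∉ S ∋ i`),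
so `dim (k[Y]/(Yᵢ, g_c))_{·} + (r+1) = n = dim (k[Y]/(g_c))_{Q'} + r` (✓ `CIJacobian.ringKrullDim_stalk_add_eq_of_det_not_mem`); were `Yᵢ/1 ∈ (g_c)_{Q'}`, the two local rings would be
isomorphic — contradiction.
* §1 `exists_det_ne_zero_of_linearIndependent_rows` (linear algebra: independent rows ⇒ a non-vanishing maximal minor), `natCast_add_eq_natCast` (dimension arithmetic in `WithBot ℕ∞`);
* §2 `det_cons_X_eq` (the augmented minor), `algebraMap_X_not_mem_of_minor` (the dimension count ⇒ `Yᵢ/1 ∉ (g_c)k[Y]_P`);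
* §3 ★★ `hon_of_geomCINondegenerate`.
For `r = 1` this is ✓ `hon_of_geomWeaklyNondegenerate` (✓ `isCINondegenerateAlong_one_iff`).
[cite: IshiiSingularities2018, Lemma 4.4.24] [cite: Matsumura1987, Thm. 30.4 (ii), Thm. 14.2 and Thm. 5.3] [cite: CuetoPopescupampuStepanov2023, Def. 4.2]
-/

-- single-problem summit: the doubled namespace component is forced
set_option linter.dupNamespace false

noncomputable section

open MvPolynomial

namespace Summit.ResolutionOfSingularities.ResolutionOfSingularities.Theorems.FInjectiveMacaulayfication.CINewtonChartHon

open Summit.ResolutionOfSingularities.ResolutionOfSingularities.Theorems.FInjectiveMacaulayfication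
open Literature.AlgebraicGeometry.Resolution Literature.AlgebraicGeometry.Resolution.BoubakriGreuelMarkwig CINondegenerate SliceableCentre

/-! ## §1 Linear algebra and dimension arithmetic -/

/-- From LINEARLY INDEPENDENT ROWS of an `r × ι` matrix over a field: `r` columns whose square submatrix has non-zero determinant. (The columns span `K^r` — else a non-zero
functional kills them all, contradicting independence of the rows — so `r` of them form a basis.) [folklore] -/
theorem exists_det_ne_zero_of_linearIndependent_rows {K : Type} [Field K] {r : ℕ} {ι : Type} [Fintype ι] (A : Fin r → ι → K)
    (h : LinearIndependent K A) : ∃ js : Fin r → ι, (Matrix.of fun μ l => A l (js μ)).det ≠ 0 := by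
  classical
  -- the columns span `K^r`
  set cols : ι → (Fin r → K) := fun j l => A l j with hcols
  have hspan : Submodule.span K (Set.range cols) = ⊤ := by
    by_contra hne
    obtain ⟨φ, hφ, hφ0⟩ := Submodule.exists_dual_map_eq_bot_of_lt_top (lt_top_iff_ne_top.mpr hne) inferInstance
    have hc : ∑ l, (φ (Pi.single l 1)) • A l = 0 := by
      funext j
      have hj : φ (cols j) = 0 := by
        have : φ (cols j) ∈ (Submodule.span K (Set.range cols)).map φ := Submodule.mem_map_of_mem (Submodule.subset_span ⟨j, rfl⟩)
        rw [hφ0] at this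
        exact (Submodule.mem_bot K).mp this
      rw [LinearMap.pi_apply_eq_sum_univ φ (cols j)] at hj
      simp only [Finset.sum_apply, Pi.smul_apply, smul_eq_mul, Pi.zero_apply]
      rw [← hj]
      refine Finset.sum_congr rfl fun l _ => ?_
      rw [hcols, smul_eq_mul, mul_comm]
      congr 2
      funext j'
      simp [Pi.single_apply, eq_comm]
    have hzero := (Fintype.linearIndependent_iff.mp h) (fun l => φ (Pi.single l 1)) hc
    apply hφ
    refine LinearMap.ext fun v => ?_
    rw [LinearMap.pi_apply_eq_sum_univ φ v, LinearMap.zero_apply]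
    refine Finset.sum_eq_zero fun l _ => ?_
    have : φ (Pi.single l 1) = 0 := hzero l
    have e : (fun j => if l = j then (1 : K) else 0) = Pi.single l 1 := by
      funext j; simp [Pi.single_apply, eq_comm]
    rw [e, this, smul_zero]
  -- a basis among the columns
  obtain ⟨κ, a, ha, hsp, hli⟩ := exists_linearIndependent' K cols
  rw [hspan] at hsp
  haveI : Finite κ := Finite.of_injective a ha
  letI : Fintype κ := Fintype.ofFinite κ
  let b : Module.Basis κ K (Fin r → K) := Module.Basis.mk hli (by rw [hsp])
  have hcard : Fintype.card κ = r := by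
    have := Module.finrank_eq_card_basis b
    rw [Module.finrank_fin_fun] at this
    exact this.symm
  let e : κ ≃ Fin r := Fintype.equivFinOfCardEq hcard
  refine ⟨a ∘ e.symm, ?_⟩
  have hrows : LinearIndependent K (fun μ : Fin r => cols (a (e.symm μ))) := by
    have : (fun μ : Fin r => cols (a (e.symm μ))) = (cols ∘ a) ∘ e.symm := rfl
    rw [this]
    exact hli.comp _ e.symm.injective
  have hunit : IsUnit (Matrix.of fun μ l => A l ((a ∘ e.symm) μ)) := by
    rw [← Matrix.linearIndependent_rows_iff_isUnit]
    exact hrows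
  exact ((Matrix.isUnit_iff_isUnit_det _).mp hunit).ne_zero

/-- Dimension arithmetic: `d + a = n` and `d + b = n` in `WithBot ℕ∞` with natural `a, b, n` force `a = b`. [plumbing] -/
theorem natCast_add_eq_natCast {d : WithBot ℕ∞} {a b n : ℕ} (ha : d + (a : WithBot ℕ∞) = (n : WithBot ℕ∞))
    (hb : d + (b : WithBot ℕ∞) = (n : WithBot ℕ∞)) : a = b := by
  induction d using WithBot.recBotCoe with
  | bot => exact absurd ha (by simp)
  | coe e =>
    rw [← WithBot.coe_natCast a, ← WithBot.coe_natCast n, ← WithBot.coe_add, WithBot.coe_inj] at ha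
    rw [← WithBot.coe_natCast b, ← WithBot.coe_natCast n, ← WithBot.coe_add, WithBot.coe_inj] at hb
    induction e using ENat.recTopCoe with
    | top => exact absurd ha (by rw [top_add]; exact ENat.top_ne_coe n)
    | coe m =>
      have h1 : m + a = n := by exact_mod_cast ha
      have h2 : m + b = n := by exact_mod_cast hb
      omega

/-- Localisations at EQUAL primes, modulo the same ideal, are isomorphic (by `subst`; used to align `Q ∩ k[Y]` with `P`). [plumbing] -/
theorem nonempty_quotLocalizationEquiv_of_eq {R : Type} [CommRing R] (J : Ideal R) {P₁ P₂ : Ideal R} [P₁.IsPrime] [P₂.IsPrime] (h : P₁ = P₂) :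
    Nonempty ((Localization.AtPrime P₁ ⧸ J.map (algebraMap R (Localization.AtPrime P₁))) ≃+*
      (Localization.AtPrime P₂ ⧸ J.map (algebraMap R (Localization.AtPrime P₂)))) := by
  subst h
  exact ⟨RingEquiv.refl _⟩

/-! ## §2 The augmented minor and `Yᵢ/1 ∉ (g)_P` -/

variable {k : Type} [Field k] {m r : ℕ}

/-- The augmented `(r+1)×(r+1)` Jacobian minor of `(Yᵢ, g₀, …, g_{r−1})` with derivations `(∂ᵢ, ∂_{js 0}, …)`, `js μ ≠ i`, equals the `r×r` minor `det(∂_{js μ} g_l)`: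
its first column is `(1, 0, …, 0)`. [plumbing] -/
theorem det_cons_X_eq (g : Fin r → MvPolynomial (Fin m) k) (i : Fin m) (js : Fin r → Fin m) (hjs : ∀ μ, js μ ≠ i) :
    (Matrix.of fun a b => ((Fin.cons ((pderiv i).restrictScalars ℤ) (fun μ => (pderiv (js μ)).restrictScalars ℤ) :
        Fin (r + 1) → Derivation ℤ (MvPolynomial (Fin m) k) (MvPolynomial (Fin m) k)) a)
        ((Fin.cons (X i) g : Fin (r + 1) → MvPolynomial (Fin m) k) b)).det =
      (Matrix.of fun μ l => pderiv (js μ) (g l)).det := by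
  rw [Matrix.det_succ_column_zero, Fin.sum_univ_succ]
  have h0 : ∀ μ : Fin r, (Matrix.of fun a b => ((Fin.cons ((pderiv i).restrictScalars ℤ) (fun μ => (pderiv (js μ)).restrictScalars ℤ) :
        Fin (r + 1) → Derivation ℤ (MvPolynomial (Fin m) k) (MvPolynomial (Fin m) k)) a)
        ((Fin.cons (X i) g : Fin (r + 1) → MvPolynomial (Fin m) k) b)) μ.succ 0 = 0 := by
    intro μ
    simp only [Matrix.of_apply, Fin.cons_succ, Fin.cons_zero, Derivation.restrictScalars_apply, pderiv_X]
    rw [Pi.single_apply, if_neg (hjs μ).symm]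
  rw [Finset.sum_eq_zero (fun μ _ => by rw [h0 μ, mul_zero, zero_mul]), add_zero]
  have h00 : (Matrix.of fun a b => ((Fin.cons ((pderiv i).restrictScalars ℤ) (fun μ => (pderiv (js μ)).restrictScalars ℤ) :
        Fin (r + 1) → Derivation ℤ (MvPolynomial (Fin m) k) (MvPolynomial (Fin m) k)) a)
        ((Fin.cons (X i) g : Fin (r + 1) → MvPolynomial (Fin m) k) b)) 0 0 = 1 := by
    simp only [Matrix.of_apply, Fin.cons_zero, Derivation.restrictScalars_apply, pderiv_X]
    rw [Pi.single_apply, if_pos rfl]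
  rw [h00, Fin.val_zero, pow_zero, one_mul, one_mul]
  congr 1

/-- **`Yᵢ/1 ∉ (g₀, …, g_{r−1})·k[Y]_P` BY DIMENSION COUNT.** `P` a maximal ideal of `k[Y]` containing `Yᵢ` and all `g_l`; `js μ ≠ i` with `det(∂_{js μ} g_l) ∉ P`. Then
`(k[Y]/(g))` and `(k[Y]/(Yᵢ, g))`, localised at the points over `P`, have dimensions `n − r` and `n − r − 1` (✓ `CIJacobian.ringKrullDim_stalk_add_eq_of_det_not_mem`, the augmented
minor `det_cons_X_eq`); if `Yᵢ/1 ∈ (g)_P` the two local rings are isomorphic (✓ `CIFedderAtMaximalIdeal.nonempty_quotLocalizationEquiv`, `Ideal.quotEquivOfEq`) — impossible.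
[cite: Matsumura1987, Thm. 30.4 (ii), Thm. 14.2] -/
theorem algebraMap_X_not_mem_of_minor (g : Fin r → MvPolynomial (Fin m) k) (P : Ideal (MvPolynomial (Fin m) k)) [P.IsMaximal]
    (hgP : ∀ l, g l ∈ P) (i : Fin m) (hiP : (X i : MvPolynomial (Fin m) k) ∈ P) (js : Fin r → Fin m) (hjs : ∀ μ, js μ ≠ i)
    (hdet : (Matrix.of fun μ l => pderiv (js μ) (g l)).det ∉ P) :
    algebraMap (MvPolynomial (Fin m) k) (Localization.AtPrime P) (X i) ∉
      (Ideal.span (Set.range g)).map (algebraMap (MvPolynomial (Fin m) k) (Localization.AtPrime P)) := by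
  classical
  intro hmem
  haveI : Fact (Nat.Prime 2) := ⟨Nat.prime_two⟩
  -- the two quotients and their maximal ideals over `P`
  set I : Ideal (MvPolynomial (Fin m) k) := Ideal.span (Set.range g) with hI
  set I' : Ideal (MvPolynomial (Fin m) k) := Ideal.span (Set.range (Fin.cons (X i) g : Fin (r + 1) → MvPolynomial (Fin m) k)) with hI'
  have hIP : I ≤ P := Ideal.span_le.mpr (by rintro _ ⟨l, rfl⟩; exact hgP l)
  have hI'P : I' ≤ P := Ideal.span_le.mpr (by
    rintro _ ⟨b, rfl⟩
    refine Fin.cases ?_ (fun l => ?_) b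
    · simpa only [Fin.cons_zero, SetLike.mem_coe] using hiP
    · simpa only [Fin.cons_succ, SetLike.mem_coe] using hgP l)
  -- maximal ideals `Q = P/I`, `Q' = P/I'`
  have hQmax : ∀ (J : Ideal (MvPolynomial (Fin m) k)), J ≤ P → (P.map (Ideal.Quotient.mk J)).IsMaximal ∧
      (P.map (Ideal.Quotient.mk J)).comap (Ideal.Quotient.mk J) = P := by
    intro J hJ
    have hcomap : (P.map (Ideal.Quotient.mk J)).comap (Ideal.Quotient.mk J) = P := by
      rw [Ideal.comap_map_of_surjective _ Ideal.Quotient.mk_surjective, ← RingHom.ker_eq_comap_bot, Ideal.mk_ker, sup_eq_left.mpr hJ]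
    refine ⟨(Ideal.map_eq_top_or_isMaximal_of_surjective _ Ideal.Quotient.mk_surjective ‹P.IsMaximal›).resolve_left fun htop => ?_, hcomap⟩
    have := hcomap
    rw [htop, Ideal.comap_top] at this
    exact ‹P.IsMaximal›.ne_top this.symm
  obtain ⟨hQ, hQc⟩ := hQmax I hIP
  obtain ⟨hQ', hQ'c⟩ := hQmax I' hI'P
  haveI := hQ
  haveI := hQ'
  -- the two dimension counts
  have hD : ringKrullDim (Localization.AtPrime (P.map (Ideal.Quotient.mk I))) + (r : WithBot ℕ∞) = (m : WithBot ℕ∞) := by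
    refine CIJacobian.ringKrullDim_stalk_add_eq_of_det_not_mem k m r g (P.map (Ideal.Quotient.mk I)) (fun μ => (pderiv (js μ)).restrictScalars ℤ) ?_
    rw [hQc]
    simpa only [Derivation.restrictScalars_apply] using hdet
  have hD' : ringKrullDim (Localization.AtPrime (P.map (Ideal.Quotient.mk I'))) + ((r + 1 : ℕ) : WithBot ℕ∞) = (m : WithBot ℕ∞) := by
    refine CIJacobian.ringKrullDim_stalk_add_eq_of_det_not_mem k m (r + 1) (Fin.cons (X i) g) (P.map (Ideal.Quotient.mk I'))
      (Fin.cons ((pderiv i).restrictScalars ℤ) (fun μ => (pderiv (js μ)).restrictScalars ℤ)) ?_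
    rw [hQ'c, det_cons_X_eq g i js hjs]
    exact hdet
  -- if `Yᵢ/1 ∈ I_P` then `I'_P = I_P`, so the two local rings are isomorphic
  set A := Localization.AtPrime P with hA
  have hmapeq : I'.map (algebraMap (MvPolynomial (Fin m) k) A) = I.map (algebraMap (MvPolynomial (Fin m) k) A) := by
    apply le_antisymm
    · rw [hI', Ideal.map_span]
      refine Ideal.span_le.mpr ?_
      rintro _ ⟨_, ⟨b, rfl⟩, rfl⟩
      refine Fin.cases ?_ (fun l => ?_) b
      · simpa only [Fin.cons_zero, SetLike.mem_coe] using hmem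
      · simp only [Fin.cons_succ]
        exact Ideal.mem_map_of_mem _ (Ideal.subset_span ⟨l, rfl⟩)
    · refine Ideal.map_mono (Ideal.span_mono ?_)
      rintro _ ⟨l, rfl⟩
      exact ⟨l.succ, by simp only [Fin.cons_succ]⟩
  -- `A/I'A ≃ A/IA`, and both are the local rings of the quotients at the points over `P`
  have hPI : (P.map (Ideal.Quotient.mk I)).comap (Ideal.Quotient.mk I) = P := hQc
  have hPI' : (P.map (Ideal.Quotient.mk I')).comap (Ideal.Quotient.mk I') = P := hQ'c
  obtain ⟨e₁⟩ := CIFedderAtMaximalIdeal.nonempty_quotLocalizationEquiv (MvPolynomial (Fin m) k) I (P.map (Ideal.Quotient.mk I))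
  obtain ⟨e₂⟩ := CIFedderAtMaximalIdeal.nonempty_quotLocalizationEquiv (MvPolynomial (Fin m) k) I' (P.map (Ideal.Quotient.mk I'))
  -- align the comaps `P/I ∩ k[Y]`, `P/I' ∩ k[Y]` with `P`
  haveI : ((P.map (Ideal.Quotient.mk I)).comap (Ideal.Quotient.mk I)).IsPrime := Ideal.comap_isPrime _ _
  haveI : ((P.map (Ideal.Quotient.mk I')).comap (Ideal.Quotient.mk I')).IsPrime := Ideal.comap_isPrime _ _
  obtain ⟨f₁⟩ := nonempty_quotLocalizationEquiv_of_eq I hPI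
  obtain ⟨f₂⟩ := nonempty_quotLocalizationEquiv_of_eq I' hPI'
  have e₁' : (A ⧸ I.map (algebraMap (MvPolynomial (Fin m) k) A)) ≃+* Localization.AtPrime (P.map (Ideal.Quotient.mk I)) := f₁.symm.trans e₁
  have e₂' : (A ⧸ I'.map (algebraMap (MvPolynomial (Fin m) k) A)) ≃+* Localization.AtPrime (P.map (Ideal.Quotient.mk I')) := f₂.symm.trans e₂
  have e : Localization.AtPrime (P.map (Ideal.Quotient.mk I')) ≃+* Localization.AtPrime (P.map (Ideal.Quotient.mk I)) :=
    e₂'.symm.trans ((Ideal.quotEquivOfEq hmapeq).trans e₁')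
  have hdimeq := ringKrullDim_eq_of_ringEquiv e
  rw [hdimeq] at hD'
  exact absurd (natCast_add_eq_natCast hD hD') (by omega)

/-! ## §3 ★★ The per-chart clause -/

set_option maxHeartbeats 1600000 in
-- the clause binder block is large; one geometric point, one minor extraction, two transports
/-- ★★ **`hon'` FOR THE CI CLASS OVER ANY FIELD OF CHARACTERISTIC `p`.** `k` ANY field of characteristic `p`, `K ⊇ k` algebraically closed; `F₀..F_{r−1} ∈ k[X]` with
`map (algebraMap k K) ∘ F` CI-Newton-non-degenerate along every positive weight; unimodular charts `V_c` refining every dual Newton fan (`θ_{V_c} F_l = Y^{d_{c,l}}·g_{c,l}`,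
`g_{c,l}(0) ≠ 0`). Then for every chart `c` and every MAXIMAL `Q'` of `k[Y]/(g_c)` over the origin: (i) each `Yᵢ ∈ Q'` is a non-zero-divisor on `k[Y]_{Q'∩k[Y]}/(g_c)`, and (ii)
`(k[Y]/(g_c))_{Q'}` carries the CM + Frobenius-closed clause (it is REGULAR of dimension `n − r`). This is the binder `hon'` of ✓ `CIEnginePrime.ciCertificates_of_isPrime` with
`J := univ`, `Fs := F`, `gs := g`, VERBATIM. [cite: IshiiSingularities2018, Lemma 4.4.24; Matsumura1987, Thm. 30.4 (ii), Thm. 14.2, Thm. 5.3; CuetoPopescupampuStepanov2023, Def. 4.2] -/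
theorem hon_of_geomCINondegenerate (K : Type) [Field K] [Algebra k K] [IsAlgClosed K] (p : ℕ) [Fact p.Prime] [CharP k p]
    (F : Fin r → MvPolynomial (Fin m) k)
    (hND : ∀ w : Fin m → ℝ, (∀ i, 0 < w i) →
      IsCINondegenerateAlong w (fun l => ((map (algebraMap k K) (F l) : MvPolynomial (Fin m) K) : MvPowerSeries (Fin m) K)))
    (t : ℕ) (V : Fin t → Matrix (Fin m) (Fin m) ℕ) (hV : ∀ c, IsUnit ((V c).map (Nat.cast : ℕ → ℤ)).det)
    (g : Fin t → Fin r → MvPolynomial (Fin m) k) (d : Fin t → Fin r → (Fin m →₀ ℕ))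
    (hθ : ∀ c l, aeval (fun j : Fin m => ∏ i : Fin m, (X i : MvPolynomial (Fin m) k) ^ V c i j) (F l) = monomial (d c l) 1 * g c l)
    (hg0 : ∀ c l, constantCoeff (g c l) ≠ 0) :
    ∀ (c : Fin t) (Q' : Ideal (MvPolynomial (Fin m) k ⧸ Ideal.span (Set.range (g c)))) [Q'.IsMaximal],
      (∀ j ∈ (Finset.univ : Finset (Fin m)), Ideal.Quotient.mk (Ideal.span (Set.range (g c)))
        (aeval (fun j : Fin m => ∏ i : Fin m, (X i : MvPolynomial (Fin m) k) ^ V c i j) (X j : MvPolynomial (Fin m) k)) ∈ Q') →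
        (∀ i : Fin m, (X i : MvPolynomial (Fin m) k) ∈ Q'.comap (Ideal.Quotient.mk (Ideal.span (Set.range (g c)))) →
          IsSMulRegular (Localization.AtPrime (Q'.comap (Ideal.Quotient.mk (Ideal.span (Set.range (g c))))) ⧸
              (Ideal.span (Set.range (g c))).map (algebraMap (MvPolynomial (Fin m) k)
                (Localization.AtPrime (Q'.comap (Ideal.Quotient.mk (Ideal.span (Set.range (g c))))))))
            (algebraMap (MvPolynomial (Fin m) k)
              (Localization.AtPrime (Q'.comap (Ideal.Quotient.mk (Ideal.span (Set.range (g c)))))) (X i))) ∧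
        ∀ dd : ℕ, ringKrullDim (Localization.AtPrime Q') = dd → ∀ s : Fin dd → Localization.AtPrime Q',
          (Ideal.span (Set.range s)).radical.IsMaximal →
            RingTheory.Sequence.IsWeaklyRegular (Localization.AtPrime Q') (List.ofFn s) ∧
            ∀ y : Localization.AtPrime Q', (∃ e : ℕ, y ^ p ^ e ∈ Ideal.span
              ((fun z : Localization.AtPrime Q' => z ^ p ^ e) ''
                (Ideal.span (Set.range s) : Set (Localization.AtPrime Q')))) → y ∈ Ideal.span (Set.range s) := by
  classical
  intro c Q' _ hover
  set P : Ideal (MvPolynomial (Fin m) k) := Q'.comap (Ideal.Quotient.mk (Ideal.span (Set.range (g c)))) with hPdef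
  haveI hPmax : P.IsMaximal := Ideal.comap_isMaximal_of_surjective _ Ideal.Quotient.mk_surjective
  -- the geometric point `y ∈ Kᵐ` of `P` and its zero pattern `S`
  obtain ⟨y, hy⟩ := MvPolynomial.eq_vanishingIdeal_singleton_of_isMaximal K hPmax
  have hmem : ∀ h : MvPolynomial (Fin m) k, h ∈ P ↔ aeval y h = 0 := fun h => by
    rw [hy, MvPolynomial.mem_vanishingIdeal_singleton_iff]
  set S : Finset (Fin m) := Finset.univ.filter fun i => y i = 0 with hS
  have hyS : ∀ i, y i = 0 ↔ i ∈ S := fun i => by simp [hS]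
  -- the orbit of `y` lies over the origin
  have hpos : ∀ j : Fin m, 0 < ∑ i ∈ S, V c i j := by
    refine NewtonChartHonAnyField.sum_row_pos_of_aeval_theta_X k K (V c) y S hyS (fun j => ?_)
    have h1 : aeval (fun j : Fin m => ∏ i : Fin m, (X i : MvPolynomial (Fin m) k) ^ V c i j) (X j : MvPolynomial (Fin m) k) ∈ P :=
      hover j (Finset.mem_univ j)
    rw [aeval_X, hmem] at h1
    exact h1
  -- all `g_{c,l}` vanish at `y`
  have hgP : ∀ l, g c l ∈ P := fun l => by
    rw [hPdef, Ideal.mem_comap, Ideal.Quotient.eq_zero_iff_mem.mpr (Ideal.subset_span (Set.mem_range_self l))]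
    exact Q'.zero_mem
  have hgy : ∀ l, aeval y (g c l) = 0 := fun l => (hmem _).mp (hgP l)
  -- (A2): independent rows off `S`, hence a non-vanishing minor
  have hLI := CINewtonChartLemma.ci_rank_of_chart K F hND (V c) (hV c) (d c) (g c) (hθ c) (hg0 c) S hpos y hyS hgy
  obtain ⟨js', hdet'⟩ := exists_det_ne_zero_of_linearIndependent_rows _ hLI
  set js : Fin r → Fin m := fun μ => (js' μ : Fin m) with hjs
  have hjsS : ∀ μ, js μ ∉ S := fun μ => (js' μ).2
  have hdet : (Matrix.of fun μ l => pderiv (js μ) (g c l)).det ∉ P := by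
    intro hin
    apply hdet'
    have h := (hmem _).mp hin
    have hM : (Matrix.of fun μ l => aeval y (pderiv ((js' μ : Fin m)) (g c l))) =
        (Matrix.of fun μ l => pderiv (js μ) (g c l)).map (aeval y) := by
      ext μ l
      rfl
    rw [hM, ← AlgHom.mapMatrix_apply, ← AlgHom.map_det]
    exact h
  refine ⟨fun i hi => ?_, ?_⟩
  · -- (i) `Yᵢ` is a non-zero-divisor: the quotient of the localisation is a domain and `Yᵢ/1 ∉ (g_c)_P`
    have hiS : i ∈ S := by
      rw [← hyS, ← aeval_X (R := k) y i, ← hmem]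
      exact hi
    have hjsi : ∀ μ, js μ ≠ i := fun μ h => hjsS μ (h ▸ hiS)
    have hnot := algebraMap_X_not_mem_of_minor (g c) P hgP i hi js hjsi hdet
    -- domain
    obtain ⟨hreg, hdom, -, -⟩ := CIJacobian.ci_clause_of_det_not_mem p k m r (g c) Q' (fun μ => (pderiv (js μ)).restrictScalars ℤ)
      (by simpa only [Derivation.restrictScalars_apply] using hdet)
    haveI := hdom
    obtain ⟨e₀⟩ := CIFedderAtMaximalIdeal.nonempty_quotLocalizationEquiv (MvPolynomial (Fin m) k) (Ideal.span (Set.range (g c))) Q'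
    haveI : IsDomain (Localization.AtPrime P ⧸ (Ideal.span (Set.range (g c))).map (algebraMap (MvPolynomial (Fin m) k) (Localization.AtPrime P))) :=
      MulEquiv.isDomain _ e₀.toMulEquiv
    set J : Ideal (Localization.AtPrime P) := (Ideal.span (Set.range (g c))).map (algebraMap (MvPolynomial (Fin m) k) (Localization.AtPrime P)) with hJ
    have hne : Ideal.Quotient.mk J (algebraMap (MvPolynomial (Fin m) k) (Localization.AtPrime P) (X i)) ≠ 0 := fun h0 =>
      hnot (Ideal.Quotient.eq_zero_iff_mem.mp h0)
    intro a b hab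
    obtain ⟨a, rfl⟩ := Ideal.Quotient.mk_surjective a
    obtain ⟨b, rfl⟩ := Ideal.Quotient.mk_surjective b
    have hab' : Ideal.Quotient.mk J (algebraMap (MvPolynomial (Fin m) k) (Localization.AtPrime P) (X i)) * Ideal.Quotient.mk J a =
        Ideal.Quotient.mk J (algebraMap (MvPolynomial (Fin m) k) (Localization.AtPrime P) (X i)) * Ideal.Quotient.mk J b := by
      have e : ∀ z : Localization.AtPrime P, algebraMap (MvPolynomial (Fin m) k) (Localization.AtPrime P) (X i) • Ideal.Quotient.mk J z =
          Ideal.Quotient.mk J (algebraMap (MvPolynomial (Fin m) k) (Localization.AtPrime P) (X i)) * Ideal.Quotient.mk J z := fun z => by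
        rw [← map_mul]
        rfl
      rw [← e, ← e]
      exact hab
    exact mul_left_cancel₀ hne hab'
  · -- (ii) the clause: `ci_clause_of_det_not_mem`
    obtain ⟨-, -, hcl, -⟩ := CIJacobian.ci_clause_of_det_not_mem p k m r (g c) Q' (fun μ => (pderiv (js μ)).restrictScalars ℤ)
      (by simpa only [Derivation.restrictScalars_apply] using hdet)
    exact hcl

end Summit.ResolutionOfSingularities.ResolutionOfSingularities.Theorems.FInjectiveMacaulayfication.CINewtonChartHon

end
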